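import Literature.NumberTheory.Automorphic.BaseChangeArchimedeanProofs
import Literature.NumberTheory.Automorphic.BaseChangeGLnProofs
import Literature.NumberTheory.Automorphic.StrongMultiplicityOneRepData
import Literature.NumberTheory.Automorphic.AutomorphicRepInfinitesimalCharacter
import HarnessLib

/-!
# Arthur–Clozel strong lifting at the archimedean places: the universal clause ("EVERY cuspidal
# weak lift has the restricted parameter") is its existence form plus strong multiplicity one

Topic `Literature/NumberTheory/Automorphic`; a proof file (theorems only: no definition, no named
fact, no instance), written for the named fact `ArthurClozel1989_strongLifting_archimedean`
(`BaseChangeArchimedean`; J. Arthur, L. Clozel, *Simple algebras, base change, and the advanced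
theory of the trace formula*, Ann. of Math. Stud. 120 (1989), Ch. 3, Thm. 5.1 with Ch. 1 §7), next to
`BaseChangeArchimedeanProofs` (`n = 0`), `BaseChangeArchimedeanRankOne` (`n = 1`),
`BaseChangeArchimedeanUnitaryReduction` (clean unitary data) and
`BaseChangeArchimedeanCentralCharacter` (the centre of the fact).

**What is separated here.**  The tree's fact quantifies over EVERY pair of cuspidal Borel–Jacquet
data `π` on `GL_n(𝔸_F)`, `P` on `GL_n(𝔸_E)` with `P` a weak base change lift of `π` (Def. 1.1, the
a.e. Satake relation `IsWeakBaseChangeLiftAE`) and asserts that `τ ↦ χ_π(τ|_F)` is an archimedean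
parameter of `P` — Arthur–Clozel's Thm. 5.1 ("a weak lifting is a strong lifting") read at the
archimedean places.  In print this has two ingredients of different nature:

1. the EXISTENCE of one lift with the right archimedean components — Thm. 4.2 (a): the base change
   `BC_{E/F}(π)` is constructed place by place from the local liftings, the archimedean one being
   "restriction on the Weil group side" (Ch. 1 §7), so its Harish-Chandra parameter at `τ` is
   `χ_π(τ|_F)`; and
2. RIGIDITY — two cuspidal automorphic representations of `GL_n(𝔸_E)` with the same Satake
   parameters almost everywhere coincide, archimedean components included (Jacquet–Shalika 1981,
   Thm. 4.4; in Arthur–Clozel this is how Thm. 5.1 is reduced to the comparison of traces, Ch. 3 §5).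

Ingredient 2 is a theorem OF THE TREE modulo its two standard `L²` leaves
(`CuspidalAutomorphicRepData.hasArchParameter_eq_of_isNearlyEquivalent` of
`StrongMultiplicityOneRepData`, from `hasSatakeParamAt_iff_L2` — Borel–Jacquet 1979, 4.6 — and
`strong_multiplicity_one_gl_sphericalLevel` — Jacquet–Shalika 1981, Thm. 4.4), and every
Borel–Jacquet datum HAS an archimedean parameter
(`AutomorphicRepData.exists_hasArchParameter_gl`, Schur's lemma, proved).  Hence:

* `IsWeakBaseChangeLiftAE.isNearlyEquivalent` — **two weak base change lifts of the same `π` are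
  nearly equivalent** (both carry `t_{π,v}^{f(w|v)}` at almost every `w`; Flath for `π`).
* `ArthurClozel1989_strongLifting_archimedean.of_exists` — **the named fact follows from its
  existence form** ("if `π` has a cuspidal weak lift to `E` at all, then it has one with archimedean
  parameter `τ ↦ χ_π(τ|_F)`") **together with the two `L²` leaves of strong multiplicity one over
  `E`**: given any cuspidal weak lift `P`, take the good lift `P₀`; `P` and `P₀` are nearly
  equivalent, `P` has some parameter `χ_P`, and rigidity gives `χ_P = χ_π ∘ (·|_F)`.  (`n = 0` is
  the degenerate `ArthurClozel1989_strongLifting_archimedean.rank_zero`.)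
* `ArthurClozel1989_strongLifting_archimedean.exists_of` — conversely the fact gives the existence
  form outright (take `P₀ = P`), so modulo the `L²` leaves the two forms are EQUIVALENT
  (`ArthurClozel1989_strongLifting_archimedean_iff_exists_of_smo`).

So a future discharge of the fact may construct ONE lift with controlled archimedean parameter
(the shape in which Thm. 4.2 (a) is proved, and in which the routes consume it: the lift produced by
`ArthurClozel1989_strongLifting_cuspidal` made regular algebraic) and leave the universal clause to
Jacquet–Shalika.  Nothing here assumes the fact; no statement of the tree is modified; the
existence form is NOT minted as a new named fact (it is an explicit hypothesis).

## References

* J. Arthur, L. Clozel, Ann. of Math. Stud. 120 (1989), Ch. 3: Def. 1.1, Thm. 4.2 (a), Thm. 5.1 and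
  its proof (§5); Ch. 1 §7. [ArthurClozelAMS120]
* H. Jacquet, J. A. Shalika, *On Euler products and the classification of automorphic forms II*,
  Amer. J. Math. 103 (1981), Thm. 4.4. [JacquetShalikaAJM1981II]
* A. Borel, H. Jacquet, *Automorphic forms and automorphic representations*, Corvallis 1979, §4.6.
  [BorelJacquetCorvallis1979]
-/

noncomputable section

open scoped MatrixGroups Classical
open NumberField IsDedekindDomain MeasureTheory Filter

namespace Literature.NumberTheory.Automorphic

/-! ### Two weak lifts of one `π` are nearly equivalent -/

section NearlyEquivalent

variable {n : ℕ} {F E : Type} [Field F] [NumberField F] [Field E] [NumberField E] [Algebra F E]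
  {hF : isCompact_glFiniteIntegralLevel n F} {hE : isCompact_glFiniteIntegralLevel n E}

/-- **Two weak base change lifts of the same `π` are nearly equivalent** (Arthur–Clozel 1989,
Ch. 3, (1.1): the lifted Satake datum `t_{π,v}^{f(w|v)}` is determined by `π`).  At almost every
`w`, `π` has a Satake parameter `α` at the place below (Flath, `hasSatakeParamAt_cofinite_holds`,
through `IsWeakBaseChangeLiftAE.eventually_exists`), unique (`hasSatakeParamAt_unique_holds`), and
both lifts carry `α ^ f(w|v)` there. [cite: ArthurClozelAMS120, Ch. 3 Def. 1.1] -/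
theorem IsWeakBaseChangeLiftAE.isNearlyEquivalent
    {π : AutomorphicRepData (AutomorphyDatum.gl n F hF)}
    {P P' : AutomorphicRepData (AutomorphyDatum.gl n E hE)}
    (h : IsWeakBaseChangeLiftAE π P) (h' : IsWeakBaseChangeLiftAE π P') :
    P.IsNearlyEquivalent P' := by
  change ∀ᶠ w : HeightOneSpectrum (𝓞 E) in cofinite,
    ∃ β : Multiset ℂ, P.HasSatakeParamAt w β ∧ P'.HasSatakeParamAt w β
  filter_upwards [h.eventually_exists, h'.eventually_exists] with w ⟨α, hα, hP⟩ ⟨α', hα', hP'⟩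
  obtain rfl : α' = α := π.hasSatakeParamAt_unique_holds hα' hα
  exact ⟨_, hP, hP'⟩

end NearlyEquivalent

/-! ### The universal clause from the existence form and strong multiplicity one -/

/-- **Arthur–Clozel's archimedean clause from its existence form plus strong multiplicity one.**
Assume (`hL2`, `hsmo`) the two `L²` leaves of strong multiplicity one for `GL_n` over every number
field `E` — `hasSatakeParamAt_iff_L2` (Borel–Jacquet 1979, 4.6) and
`strong_multiplicity_one_gl_sphericalLevel` (Jacquet–Shalika 1981, Thm. 4.4) — and (`hex`) the
EXISTENCE form of the clause: for `E/F` cyclic of prime degree and cuspidal `π` on `GL_n(𝔸_F)`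
admitting some cuspidal weak base change lift to `E`, and every archimedean parameter `χ` of `π`,
there is a cuspidal weak lift `P₀` with archimedean parameter `τ ↦ χ(τ|_F)` (Arthur–Clozel, Thm.
4.2 (a) with Ch. 1 §7).  Then the named fact `ArthurClozel1989_strongLifting_archimedean` holds:
for `n = 0` by `….rank_zero`; for `n ≥ 1`, a cuspidal weak lift `P` and the good lift `P₀` are
nearly equivalent (`IsWeakBaseChangeLiftAE.isNearlyEquivalent`), `P` has an archimedean parameter
`χ_P` (`AutomorphicRepData.exists_hasArchParameter_gl`), and
`CuspidalAutomorphicRepData.hasArchParameter_eq_of_isNearlyEquivalent` (for the automorphic measure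
of `AdelicGroupData.exists_isAutomorphicMeasure_gl_holds`) gives `χ_P = χ ∘ (·|_F)`.
[cite: ArthurClozelAMS120, Ch. 3 Thm. 4.2 (a), Thm. 5.1 and Ch. 1 §7]
[cite: JacquetShalikaAJM1981II, Thm. 4.4] -/
theorem ArthurClozel1989_strongLifting_archimedean.of_exists
    (hL2 : ∀ (n : ℕ) (E : Type) [Field E] [NumberField E] (hE : isCompact_glFiniteIntegralLevel n E)
      (μ : Measure (AdelicGroupData.gl n E).automorphicQuotient)
      [(AdelicGroupData.gl n E).IsAutomorphicMeasure μ], hasSatakeParamAt_iff_L2 hE μ)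
    (hsmo : ∀ (n : ℕ) (E : Type) [Field E] [NumberField E],
      strong_multiplicity_one_gl_sphericalLevel n E)
    (hex : ∀ (n : ℕ) (F E : Type) [Field F] [NumberField F] [Field E] [NumberField E] [Algebra F E]
      [IsGalois F E] (hF : isCompact_glFiniteIntegralLevel n F)
      (hE : isCompact_glFiniteIntegralLevel n E), IsCyclic (E ≃ₐ[F] E) →
        (Module.finrank F E).Prime →
          ∀ (π : CuspidalAutomorphicRepData n F hF),
            (∃ P : CuspidalAutomorphicRepData n E hE, IsWeakBaseChangeLiftAE π.1 P.1) →
              ∀ χ : (F →+* ℂ) → Multiset ℂ, π.1.HasArchParameter χ →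
                ∃ P₀ : CuspidalAutomorphicRepData n E hE, IsWeakBaseChangeLiftAE π.1 P₀.1 ∧
                  P₀.1.HasArchParameter fun τ => χ (τ.comp (algebraMap F E))) :
    ArthurClozel1989_strongLifting_archimedean := by
  intro n F E _ _ _ _ _ _ hF hE hcyc hprime π P hBC χ hχ
  rcases Nat.eq_zero_or_pos n with hn | hn
  · subst hn
    exact ArthurClozel1989_strongLifting_archimedean.rank_zero F E hF hE π P χ hχ
  · haveI : NeZero n := ⟨hn.ne'⟩
    obtain ⟨P₀, hBC₀, hP₀⟩ := hex n F E hF hE hcyc hprime π ⟨P, hBC⟩ χ hχ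
    obtain ⟨χP, hχP⟩ := P.1.exists_hasArchParameter_gl
    obtain ⟨μm, hμm⟩ := AdelicGroupData.exists_isAutomorphicMeasure_gl_holds n E
    haveI := hμm
    have e : χP = fun τ => χ (τ.comp (algebraMap F E)) :=
      CuspidalAutomorphicRepData.hasArchParameter_eq_of_isNearlyEquivalent (hL2 n E hE μm)
        (hsmo n E) P P₀ (hBC.isNearlyEquivalent hBC₀) hχP hP₀
    exact e ▸ hχP

/-- **Conversely, the fact gives its existence form outright** (take `P₀ = P`): so, granted the
`L²` leaves of strong multiplicity one, the universal clause and the existence form are the same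
debt. [cite: ArthurClozelAMS120, Ch. 3 Thm. 5.1 and Ch. 1 §7] -/
theorem ArthurClozel1989_strongLifting_archimedean.exists_of
    (h : ArthurClozel1989_strongLifting_archimedean) (n : ℕ) (F E : Type) [Field F] [NumberField F]
    [Field E] [NumberField E] [Algebra F E] [IsGalois F E] (hF : isCompact_glFiniteIntegralLevel n F)
    (hE : isCompact_glFiniteIntegralLevel n E) (hcyc : IsCyclic (E ≃ₐ[F] E))
    (hprime : (Module.finrank F E).Prime) (π : CuspidalAutomorphicRepData n F hF)
    (hP : ∃ P : CuspidalAutomorphicRepData n E hE, IsWeakBaseChangeLiftAE π.1 P.1)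
    (χ : (F →+* ℂ) → Multiset ℂ) (hχ : π.1.HasArchParameter χ) :
    ∃ P₀ : CuspidalAutomorphicRepData n E hE, IsWeakBaseChangeLiftAE π.1 P₀.1 ∧
      P₀.1.HasArchParameter fun τ => χ (τ.comp (algebraMap F E)) := by
  obtain ⟨P, hBC⟩ := hP
  exact ⟨P, hBC, h n F E hF hE hcyc hprime π P hBC χ hχ⟩

/-- **The two forms are equivalent modulo strong multiplicity one**: granted the `L²` leaves
`hasSatakeParamAt_iff_L2` and `strong_multiplicity_one_gl_sphericalLevel` over every `E`, the named
fact `ArthurClozel1989_strongLifting_archimedean` (EVERY cuspidal weak lift has the restricted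
parameter; Thm. 5.1) is equivalent to its existence form (SOME cuspidal weak lift does, whenever
one exists; Thm. 4.2 (a) with Ch. 1 §7). [cite: ArthurClozelAMS120, Ch. 3 Thm. 4.2 (a), Thm. 5.1]
[cite: JacquetShalikaAJM1981II, Thm. 4.4] -/
theorem ArthurClozel1989_strongLifting_archimedean_iff_exists_of_smo
    (hL2 : ∀ (n : ℕ) (E : Type) [Field E] [NumberField E] (hE : isCompact_glFiniteIntegralLevel n E)
      (μ : Measure (AdelicGroupData.gl n E).automorphicQuotient)
      [(AdelicGroupData.gl n E).IsAutomorphicMeasure μ], hasSatakeParamAt_iff_L2 hE μ)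
    (hsmo : ∀ (n : ℕ) (E : Type) [Field E] [NumberField E],
      strong_multiplicity_one_gl_sphericalLevel n E) :
    ArthurClozel1989_strongLifting_archimedean ↔
      ∀ (n : ℕ) (F E : Type) [Field F] [NumberField F] [Field E] [NumberField E] [Algebra F E]
        [IsGalois F E] (hF : isCompact_glFiniteIntegralLevel n F)
        (hE : isCompact_glFiniteIntegralLevel n E), IsCyclic (E ≃ₐ[F] E) →
          (Module.finrank F E).Prime →
            ∀ (π : CuspidalAutomorphicRepData n F hF),
              (∃ P : CuspidalAutomorphicRepData n E hE, IsWeakBaseChangeLiftAE π.1 P.1) →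
                ∀ χ : (F →+* ℂ) → Multiset ℂ, π.1.HasArchParameter χ →
                  ∃ P₀ : CuspidalAutomorphicRepData n E hE, IsWeakBaseChangeLiftAE π.1 P₀.1 ∧
                    P₀.1.HasArchParameter fun τ => χ (τ.comp (algebraMap F E)) :=
  ⟨fun h n F E _ _ _ _ _ _ hF hE hcyc hprime π hP χ hχ =>
      h.exists_of n F E hF hE hcyc hprime π hP χ hχ,
    fun hex => ArthurClozel1989_strongLifting_archimedean.of_exists hL2 hsmo hex⟩

end Literature.NumberTheory.Automorphic

end
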